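import Literature.Probability.RandomPlanarGeometry.HexSAWStripWidthTwoContactKurtosis
import HarnessLib

/-!
# The width-two strip at criticality: the surface-contact count of long bridges is asymptotically UNSKEWED and MESOKURTIC —
# `skewness² → 0`, `excess kurtosis → 0`, `m₄/n² → 3σ₂⁴` (module «WIDTH-TWO CONTACT SHAPE»)

Topic `Literature/Probability/RandomPlanarGeometry` (continues «WIDTH-TWO CONTACT VARIANCE» #1137 (`W2.tendsto_varTopTwo_div_hatLen`: `Var/n → σ₂² = (96 − 67√2)/8`),
«WIDTH-TWO CONTACT SKEWNESS» (`W2.tendsto_thirdTopTwo_div_hatLen`: `m₃/n → κ₃ = (13836 − 9785√2)/16`) and «WIDTH-TWO CONTACT KURTOSIS»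
(`W2.tendsto_fourthTopTwo_div_hatLen`: `(m₄ − 3Var²)/n → κ₄ = (3339420 − 2361331√2)/32`)).  Lane «pcv-sawmu» (CriticalPhenomena venture), a-p2 g29; the `T = 3`
twin is «WIDTH-THREE CONTACT SHAPE».  For the number `N` of surface contacts of a critical `S₂` bridge `a → b` with `n = 2k + χ_a − χ_b` steps: squared skewness
`m₃²/Var³ → 0`, excess kurtosis `(m₄ − 3Var²)/Var² → 0`, `m₄ ∼ 3σ₂⁴n²` — the third and fourth standardized moments converge to the Gaussian values `0` and `3`.
Frame: W. Feller, vol. II (1971) XVI.5; nothing below is printed.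

## What is proved (namespace `…SAW.HV.W2`)
* `tendsto_inv_hatLen_two`, `varRateTwo_pos` (`(96 − 67√2)/8 > 0`), `one_le_hatLen_two`, `eventually_varTopTwo_pos`.
* ★★ **`tendsto_skewSq_two`**: `thirdTopTwo k a b ^ 2 / varTopTwo k a b ^ 3 → 0`.
* ★★ **`tendsto_excessKurt_two`**: `fourthTopTwo k a b / varTopTwo k a b ^ 2 → 0`.
* ★★ **`tendsto_fourthCentral_div_sq_two`**: `(fourthTopTwo k a b + 3·varTopTwo k a b ^ 2) / n² → 3·((96 − 67√2)/8)²`.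

Label: LANE THEOREM (own result of lane «pcv-sawmu», a-p2 g29, 2026-08-28; not in print).  NOT claimed: the CLT itself.
-/

noncomputable section

open Filter Topology Literature.Probability.LatticeModels Literature.Probability.Percolation

namespace Literature.Probability.RandomPlanarGeometry.SAW

namespace HV

namespace W2

/-- `1/(2k + χ_a − χ_b) → 0` (plumbing). [cite: Feller1968, XIII.3; lane plumbing] -/
theorem tendsto_inv_hatLen_two (a b : Fin (2 * 2)) :
    Tendsto (fun k : ℕ => (((hatLen k a b : ℤ) : ℝ))⁻¹) atTop (𝓝 0) := by
  have h1 := tendsto_div_hatLen_two a b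
  have h2 : Tendsto (fun k : ℕ => ((k : ℝ))⁻¹) atTop (𝓝 0) := tendsto_inv_atTop_zero.comp tendsto_natCast_atTop_atTop
  have t := h1.mul h2
  rw [mul_zero] at t
  refine t.congr' ?_
  filter_upwards [eventually_gt_atTop 0] with k hk
  have hk' : (k : ℝ) ≠ 0 := by exact_mod_cast hk.ne'
  field_simp

/-- `σ₂² = (96 − 67√2)/8 > 0` (plumbing). [cite: Feller1968, XIII.6; lane plumbing] -/
theorem varRateTwo_pos : (0 : ℝ) < (96 - 67 * Real.sqrt 2) / 8 := by
  have h := W3.sqrt_two_window15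
  linarith [h.2]

/-- `1 ≤ 2k + χ_a − χ_b` for `k ≥ 1` (plumbing). [cite: Feller1968, XIII.3; lane plumbing] -/
theorem one_le_hatLen_two (a b : Fin (2 * 2)) {k : ℕ} (hk : 0 < k) : (1 : ℝ) ≤ ((hatLen k a b : ℤ) : ℝ) := by
  have h01 := (lchi_facts a).1
  have h02 := (lchi_facts b).1
  have h1 : (1 : ℤ) ≤ hatLen k a b := by
    unfold hatLen
    rcases h01 with h | h <;> rcases h02 with h' | h' <;> omega
  exact_mod_cast h1

/-- Eventually `varTopTwo k a b > 0` (plumbing: `Var/n → σ₂² > 0` and `n > 0`). [cite: Feller1968, XIII.6; lane plumbing] -/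
theorem eventually_varTopTwo_pos (a b : Fin (2 * 2)) : ∀ᶠ k : ℕ in atTop, 0 < varTopTwo k a b := by
  have h := tendsto_varTopTwo_div_hatLen a b
  have hev := h.eventually (Ioi_mem_nhds (half_lt_self varRateTwo_pos))
  filter_upwards [hev, eventually_gt_atTop 0] with k hk hk0
  have hL : (0 : ℝ) < ((hatLen k a b : ℤ) : ℝ) := lt_of_lt_of_le one_pos (one_le_hatLen_two a b hk0)
  have hq : 0 < varTopTwo k a b / ((hatLen k a b : ℤ) : ℝ) := lt_trans (half_pos varRateTwo_pos) hk
  rcases le_or_gt (varTopTwo k a b) 0 with hneg | hpos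
  · exfalso
    have : varTopTwo k a b / ((hatLen k a b : ℤ) : ℝ) ≤ 0 := div_nonpos_of_nonpos_of_nonneg hneg hL.le
    linarith
  · exact hpos

/-- ★★ **Squared skewness → 0**: `m₃² / Var³ → 0` for the contact count of critical `S₂` bridges `a → b` (`= (κ₃²/σ₂⁶)/n + o(1/n)`).
[cite: Feller1968, XIII.6; lane «pcv-sawmu» a-p2 g29 — own result, not in print] -/
theorem tendsto_skewSq_two (a b : Fin (2 * 2)) :
    Tendsto (fun k : ℕ => thirdTopTwo k a b ^ 2 / varTopTwo k a b ^ 3) atTop (𝓝 0) := by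
  have h3 := tendsto_thirdTopTwo_div_hatLen a b
  have h2 := tendsto_varTopTwo_div_hatLen a b
  have hi := tendsto_inv_hatLen_two a b
  have hσ : ((96 - 67 * Real.sqrt 2) / 8 : ℝ) ^ 3 ≠ 0 := pow_ne_zero 3 varRateTwo_pos.ne'
  have t := ((h3.pow 2).div (h2.pow 3) hσ).mul hi
  rw [mul_zero] at t
  refine t.congr' ?_
  filter_upwards [eventually_varTopTwo_pos a b, eventually_gt_atTop 0] with k hv hk0
  have hL : ((hatLen k a b : ℤ) : ℝ) ≠ 0 := by linarith [one_le_hatLen_two a b hk0]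
  have hv' : varTopTwo k a b ≠ 0 := hv.ne'
  simp only [Pi.div_apply]
  field_simp

/-- ★★ **Excess kurtosis → 0**: `(m₄ − 3Var²) / Var² → 0` for the contact count of critical `S₂` bridges `a → b` (`= (κ₄/σ₂⁴)/n + o(1/n)`).
[cite: Feller1968, XIII.6; lane «pcv-sawmu» a-p2 g29 — own result, not in print] -/
theorem tendsto_excessKurt_two (a b : Fin (2 * 2)) :
    Tendsto (fun k : ℕ => fourthTopTwo k a b / varTopTwo k a b ^ 2) atTop (𝓝 0) := by
  have h4 := tendsto_fourthTopTwo_div_hatLen a b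
  have h2 := tendsto_varTopTwo_div_hatLen a b
  have hi := tendsto_inv_hatLen_two a b
  have hσ : ((96 - 67 * Real.sqrt 2) / 8 : ℝ) ^ 2 ≠ 0 := pow_ne_zero 2 varRateTwo_pos.ne'
  have t := (h4.div (h2.pow 2) hσ).mul hi
  rw [mul_zero] at t
  refine t.congr' ?_
  filter_upwards [eventually_varTopTwo_pos a b, eventually_gt_atTop 0] with k hv hk0
  have hL : ((hatLen k a b : ℤ) : ℝ) ≠ 0 := by linarith [one_le_hatLen_two a b hk0]
  have hv' : varTopTwo k a b ≠ 0 := hv.ne'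
  simp only [Pi.div_apply]
  field_simp

/-- ★★ **The fourth central moment is `3σ₂⁴n²`**: `(fourthTopTwo + 3·varTopTwo²) / n² → 3σ₂⁴` (`m₄ = (m₄ − 3Var²) + 3Var²`; the Gaussian fourth moment).
[cite: Feller1968, XIII.6; lane «pcv-sawmu» a-p2 g29 — own result, not in print] -/
theorem tendsto_fourthCentral_div_sq_two (a b : Fin (2 * 2)) :
    Tendsto (fun k : ℕ => (fourthTopTwo k a b + 3 * varTopTwo k a b ^ 2) / ((hatLen k a b : ℤ) : ℝ) ^ 2) atTop (𝓝 (3 * ((96 - 67 * Real.sqrt 2) / 8 : ℝ) ^ 2)) := by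
  have h4 := tendsto_fourthTopTwo_div_hatLen a b
  have h2 := tendsto_varTopTwo_div_hatLen a b
  have hi := tendsto_inv_hatLen_two a b
  have t := (h4.mul hi).add ((h2.pow 2).const_mul 3)
  rw [mul_zero, zero_add] at t
  refine t.congr' ?_
  filter_upwards [eventually_gt_atTop 0] with k hk0
  rw [div_pow]
  ring

end W2

end HV

end Literature.Probability.RandomPlanarGeometry.SAW
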